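import Summits.QuantumFields.BalabanUV.Beta.D1BFx.BlockColumnPoisson
import Summits.QuantumFields.BalabanUV.Beta.D1BFx.RProjector

/-!
# `BalabanUV.Beta.D1BFx.BlockColumnSupNorm` — road «BF-x» for binder row D1, sub-leaf **A3.a-P** (part 2 of 3):
# MESH-FREE SUP-NORM LEGS ON `ℤ^d` for the block columns `G′Q′* e_{y′}` of the B4-Sect.5 whole-lattice kernel
# (`B5Hk103ScalarZd.gq`) — value `O(1)` and gradient `O((n+1)⁻¹)`, exponentially decaying in the block distance —
# and the sup-norm bound for B5 (1.103)'s `H = G′Q′*(Q′G′Q′*)⁻¹` (`kerH`) that follows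

HONEST FRAMING (cell contract, verbatim): «discharging `BetaPertH` makes Bałaban's UV stability UNCONDITIONAL — a real constructive-QFT
result; it is NOT the continuum limit and NOT the Clay problem.»  HONEST DEPENDENCY (verbatim): «continuum YM on T⁴ ⇐ BetaPertH ∧ nine
spine estimates (0/9 proved); BetaPertH ⇐ (D1) ∧ (D4) ∧ CAP+tail; G-an2-4 gates asym, D1 and NE2/3/4.»  THIS MODULE DISCHARGES NOTHING of
that: it is an elementary elliptic-regularity estimate (kernel-checked, [folklore]) for ONE leg of ONE term class (A0 census row τ5 of road
BF-x) of ONE conjunct (D1).  0 wall binders instantiated; NOT A3.a, NOT D1, NOT BetaPertH, NOT continuum, NOT Clay.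
ABSOLUTE RULE (cell, verbatim): «No internally-minted statement may enter as a cited fact. Every hypothesis is either kernel-proved in this
package or a verbatim quotation of a PUBLISHED theorem with page reference.»  Nothing printed is asserted or cited below; every theorem is
proved outright from the tree modules `B5Hk103ScalarZd` (pv23-g7), `B6QGQDecay237`/`B6QGQLower276` (pv23), `Beta/PoissonInterior` (pv23-g4),
part 1 `D1BFx/BlockColumnPoisson`, leaf-09-g2's `D1BFx/RProjector` (only `abs_tsum_le_latticeConst`) and Mathlib; three constants WITH BODIES (`cI`, `cG`, `cHs`) are the only definitions (no `def … : Prop`).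

WHY (skeleton `HOME/beta/skeletons/D1-b2b-balaban-beta-d1-p2.md` node A3; `HOME/b2b-balaban-beta-d1-p2/A0-TERM-CENSUS.md` v1, SIZES: «`P = Δ⁻¹Q′*(Q′Δ⁻²Q′*)⁻¹Q′Δ⁻¹`
… rank-one-per-block projector, kernel `|P(x,y)| ≲ n^{−4}`, smooth at scale n», row τ5 «R-jet block part `(∂D)PD*`, `D(∂P)D*`», WHAT A LEAF OWES (1) «B5 (1.70)/`PcT`-type
bounds for P»; leaf-07 gen-2 HANDOFF «INFO for A3.a: `RProjector.abs_Pker_le`'s constant is O(1)·poly(n) — the census' `|P| ≲ n⁻⁴` is NOT in any landed ℤ⁴ file»).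
The loss sits in ONE place: the tree's entry bound `B5Hk103ScalarZd.abs_gq_le` — `|(G′Q′*)(p,y′)| ≤ c_u (n+1)^{d/2} e^{−δ_u|blk p − y′|}` — reads an
`ℓ²` Combes–Thomas bound at a point source and pays `(n+1)^{d/2}` (pv23-g7's HONEST SCOPE (iii): «NO sup-norm `O(1)` entry bound for `H(p,y)` is
claimed (that needs elliptic regularity)»).  The elliptic regularity IS in the tree since 2026-08-19: pv23-g4's discrete interior estimate
`PoissonInterior.interior_estimate` on `ℤ^d` (`d ≥ 3`), which pv23-g4's `TransportLeg.block_legs` already used for the same purpose on the TORUS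
operator `torusOp`.  This file is the `ℤ^d` TWIN of `TransportLeg.block_legs` for the whole-lattice kernel `Gk`/`gq` (the object `RProjector`, J5 and T4
are built on) — simpler than the torus case (no periodic lift).

THE ROUTE ([folklore]; `d ≥ 3`, mesh `η = 1/(n+1)` with `n : ℕ` ARBITRARY, `a > 0`; `u := (G′Q′*)(·,y′) = G′1_{B(y′)}` on `ℤ^d`).
(A) `|Δu(p)| ≤ (1[blk p = y′] + a c_u e^{−δ_u|blk p − y′|})/(n+1)²` (part 1, `BlockColumnPoisson.abs_lap_gq_le`);
(B) `Σ_{B(y″)}|u| ≤ c_u (n+1)^d e^{−δ_u|y″−y′|}` (part 1, `BlockColumnPoisson.sum_abs_gq_le`);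
(C) `interior_estimate` on the cube of radius `3⌊(n+1)/8⌋` about `p` (covered by the `3^d` blocks adjacent to `blk p`): `|u(p)| ≤ C(m²A + B/m^d)`,
    `|u(p+e_μ) − u(p)| ≤ C(mA + B/m^{d+1})`, `m ≍ n+1` ⇒ both legs mesh-free, the gradient with one factor `(n+1)⁻¹ = η`; `n+1 ≤ 7` is the crude bound.

CONTENT.  §4 the interior constant `cI d` (:= the `C(d)` of `interior_estimate`, by `Classical.choose`; `0` for `d < 3`) and THE LEGS (`gq_legs`):
**`abs_gq_le_sup`** `|gq n a p y′| ≤ cG(d,a)·e^{−δ_u|blk p − y′|_∞}`, **`abs_gq_diff_le_sup`** `|gq n a (p+e_μ) y′ − gq n a p y′| ≤ cG(d,a)·(n+1)⁻¹·e^{−δ_u|blk p − y′|_∞}`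
(+ the `p − e_μ` form `abs_gq_diff_sub_le_sup`), with `cG d a = cI d·(e² + a c_u e + 48^{d+1} c_u e) + 2·7^{d+1} c_u e` — NO power of `n+1`.
§5 the convolution of two exponential envelopes (`abs_tsum_mul_le_of_decay`, over J5.0's `abs_tsum_le_latticeConst`) and **`abs_kerH_le_sup`**: `|H(p,y)| ≤ cHs(d,a)·e^{−δ_H|blk p − y|_∞}`
(`δ_H = deltaH d a` = pv23's rate; `cHs = cG·c_inv·K_d(δ_inv/2)`) — pv23-g7's HONEST SCOPE (iii) discharged for the scalar `ℤ^d` object.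
HONEST SCOPE: scalar, `U = 1`, whole lattice `ℤ^d`, `d ≥ 3`; constants existential in `d` (through `interior_estimate`'s `C(d)`, useless for numerics,
fine for the `n`-uniformity the road needs) and explicit in `a`; one forward difference per leg (a second difference would need third differences of the
lattice Green function, which lit1's library does not have — as in `TransportLeg`).  Part 3 (`D1BFx/ProjectorSupNorm`) draws the consequences for
`kerP`, `Pker` (`|P| ≤ K(n+1)^{−d}`, `|∇P| ≤ K(n+1)^{−(d+1)}`) and the road currency `Pgt`.
-/

namespace Summit.QuantumFields.BalabanUV.Beta.D1BFx.BlockColumnSupNorm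

open Finset Real
open Literature.MathematicalPhysics.QuantumFieldTheory.Balaban1983to89
open Literature.Probability.LatticeModels (latticeLaplacianZd latticeLaplacianZd_def)
open B4Sect5Proof (latticeConst latticeConst_nonneg)
open B6QGQLower276 (X e blk B mem_B B_disjoint U mem_U sum_U sum_B_const side side_facts lapKer sameBlk AX kerQGQ)
open B6QGQDecay237 (cU deltaU cU_pos deltaU_pos deltaU_le_one abs_kerQGQ_le_unif cInv deltaInv cInv_pos deltaInv_pos)
open B5Hk103ScalarZd (Gk gq Kinv kerH abs_gq_le abs_sum_mul_gq_le sum_AX_mul_gq tsum_AX_mul tsum_lapKer_mul nbhd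
  lapKer_eq_zero_of_not_mem summable_expX tsum_expX_le exp_split_triangle abs_Kinv_le summable_kerH deltaH deltaH_pos)
open Beta.PoissonInterior (cube mem_cube interior_estimate)
open RProjector (abs_tsum_le_latticeConst)
open BlockColumnPoisson (dist_blk_add_e_le_one dist_blk_sub_e_le_one dist_blk_le_one_of_mem_cube dist_le_one_of_mem_cube_one
  cube_subset_U card_cube abs_lap_gq_le sum_abs_gq_le)

noncomputable section

variable {d : ℕ}

/-! ## §4 The interior constant and the sup-norm legs -/

/-- [our object] **The interior constant `C(d)`** of `PoissonInterior.interior_estimate` (chosen once by `Classical.choose`; `0` for `d < 3`). -/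
def cI (d : ℕ) : ℝ := if h : 3 ≤ d then Classical.choose (interior_estimate (d := d) h) else 0

/-- [folklore] `cI d ≥ 0`. -/
theorem cI_nonneg (d : ℕ) : 0 ≤ cI d := by
  unfold cI
  split_ifs with h
  · exact (Classical.choose_spec (interior_estimate (d := d) h)).1
  · exact le_rfl

/-- [folklore] The interior estimate with the named constant `cI d`. -/
theorem interior_estimate_cI (hd : 3 ≤ d) {m : ℕ} (hm : 1 ≤ m) (u : X d → ℝ) (x : X d) (A B : ℝ)
    (hA : ∀ y ∈ cube x (3 * m), |latticeLaplacianZd u y| ≤ A) (hB : (∑ y ∈ cube x (3 * m), |u y|) ≤ B) :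
    |u x| ≤ cI d * ((m : ℝ) ^ 2 * A + B / (m : ℝ) ^ d) ∧
    ∀ j : Fin d, |u (x + Pi.single j 1) - u x| ≤ cI d * ((m : ℝ) * A + B / (m : ℝ) ^ (d + 1)) := by
  have h := (Classical.choose_spec (interior_estimate (d := d) hd)).2 m hm u x A B hA hB
  have e : cI d = Classical.choose (interior_estimate (d := d) hd) := by unfold cI; rw [dif_pos hd]
  rw [e]; exact h

/-- [our object] **THE SUP-NORM LEG CONSTANT** `cG(d,a) = cI d·(e² + a c_u e + 48^{d+1} c_u e) + 2·7^{d+1} c_u e` — no power of the mesh. -/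
def cG (d : ℕ) (a : ℝ) : ℝ :=
  cI d * (Real.exp 2 + a * cU d a * Real.exp 1 + 48 ^ (d + 1) * cU d a * Real.exp 1) + 2 * 7 ^ (d + 1) * cU d a * Real.exp 1

/-- [folklore] `cG d a > 0`. -/
theorem cG_pos (d : ℕ) {a : ℝ} (ha : 0 < a) : 0 < cG d a := by
  unfold cG; have := cU_pos d ha; have := cI_nonneg d; positivity

/-- [folklore] The crude (`ℓ²`-at-a-point) bound with the volume factor made explicit: `|gq| ≤ c_u (n+1)^d e^{−δ_u D}`. -/
theorem abs_gq_le_pow (n : ℕ) {a : ℝ} (ha : 0 < a) (p y' : X d) :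
    |gq n a p y'| ≤ cU d a * ((n : ℝ) + 1) ^ d * Real.exp (-(deltaU d a * dist (blk n p) y')) := by
  refine (abs_gq_le n ha p y').trans ?_
  have h1 : (1 : ℝ) ≤ ((n : ℝ) + 1) ^ d := one_le_pow₀ (by linarith [(Nat.cast_nonneg n : (0 : ℝ) ≤ n)])
  have hs : Real.sqrt (((n : ℝ) + 1) ^ d) ≤ ((n : ℝ) + 1) ^ d := by
    rw [Real.sqrt_le_left (by positivity)]
    nlinarith
  have := cU_pos d ha
  gcongr

/-- [folklore] **THE TWO SUP-NORM LEGS OF A BLOCK COLUMN ON `ℤ^d`** (`d ≥ 3`; value and forward difference), mesh-free: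
`|(G′Q′*)(x,y′)| ≤ cG e^{−δ_u|blk x − y′|}` and `|(G′Q′*)(x+e_μ,y′) − (G′Q′*)(x,y′)| ≤ cG (n+1)⁻¹ e^{−δ_u|blk x − y′|}`. -/
theorem gq_legs (hd : 3 ≤ d) (n : ℕ) {a : ℝ} (ha : 0 < a) (x y' : X d) :
    |gq n a x y'| ≤ cG d a * Real.exp (-(deltaU d a * dist (blk n x) y')) ∧
    ∀ μ : Fin d, |gq n a (x + e μ) y' - gq n a x y'|
      ≤ cG d a / ((n : ℝ) + 1) * Real.exp (-(deltaU d a * dist (blk n x) y')) := by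
  classical
  set δ := deltaU d a with hδ
  set c := cU d a with hc
  have hδ0 : 0 < δ := deltaU_pos d ha
  have hδ1 : δ ≤ 1 := deltaU_le_one d a
  have hc0 : 0 < c := cU_pos d ha
  have hs0 : (0 : ℝ) < (n : ℝ) + 1 := by positivity
  set D := dist (blk n x) y' with hD
  have hD0 : 0 ≤ D := dist_nonneg
  set E := Real.exp (-(δ * D)) with hE
  have hE0 : 0 < E := Real.exp_pos _
  have he1 : (1 : ℝ) ≤ Real.exp 1 := Real.one_le_exp zero_le_one
  have hCI := cI_nonneg d
  -- the envelope: a block at distance `≥ D − t` from `y′` carries `e^{−δ(D−t)} ≤ e^t · E`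
  have henv : ∀ (z : X d) (t : ℝ), 0 ≤ t → D - t ≤ dist z y' → Real.exp (-(δ * dist z y')) ≤ Real.exp t * E := by
    intro z t ht hz
    rw [hE, ← Real.exp_add]
    exact Real.exp_le_exp.2 (by nlinarith)
  -- a neighbouring block of `blk x` is at distance `≥ D − 1` from `y′`
  have hnb : ∀ z : X d, dist z (blk n x) ≤ 1 → D - 1 ≤ dist z y' := by
    intro z hz
    have := dist_triangle (blk n x) z y'
    rw [dist_comm] at hz
    linarith
  set u : X d → ℝ := fun r => gq n a r y' with hu
  by_cases hn7 : n + 1 ≤ 7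
  · -- bounded mesh: the crude bound
    have hn7' : (n : ℝ) + 1 ≤ 7 := by exact_mod_cast hn7
    have hnd : ((n : ℝ) + 1) ^ d ≤ 7 ^ d := pow_le_pow_left₀ hs0.le hn7' d
    have h7 : (7 : ℝ) ^ d ≤ 7 ^ (d + 1) := pow_le_pow_right₀ (by norm_num) (by omega)
    have hpt : ∀ z : X d, |u z| ≤ c * 7 ^ d * Real.exp (-(δ * dist (blk n z) y')) := fun z =>
      (abs_gq_le_pow n ha z y').trans (by rw [← hc, ← hδ]; gcongr)
    have hcrude : 2 * 7 ^ (d + 1) * c * Real.exp 1 ≤ cG d a := by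
      unfold cG
      rw [← hc]
      have h0 : 0 ≤ cI d * (Real.exp 2 + a * c * Real.exp 1 + 48 ^ (d + 1) * c * Real.exp 1) := by positivity
      linarith
    have hKv : c * 7 ^ d ≤ cG d a := by
      refine le_trans ?_ hcrude
      calc c * 7 ^ d = 7 ^ d * c * 1 := by ring
        _ ≤ 7 ^ (d + 1) * c * (2 * Real.exp 1) := by
            apply mul_le_mul (mul_le_mul_of_nonneg_right h7 hc0.le) (by linarith) zero_le_one (by positivity)
        _ = 2 * 7 ^ (d + 1) * c * Real.exp 1 := by ring
    constructor
    · calc |gq n a x y'| = |u x| := rfl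
        _ ≤ c * 7 ^ d * E := hpt x
        _ ≤ cG d a * E := mul_le_mul_of_nonneg_right hKv hE0.le
    · intro μ
      have h1 : |u (x + e μ)| ≤ c * 7 ^ d * (Real.exp 1 * E) :=
        (hpt (x + e μ)).trans (mul_le_mul_of_nonneg_left
          (henv _ 1 zero_le_one (hnb _ (dist_blk_add_e_le_one n x μ))) (by positivity))
      have h2 : |u x| ≤ c * 7 ^ d * (Real.exp 1 * E) :=
        (hpt x).trans (mul_le_mul_of_nonneg_left (henv (blk n x) 1 zero_le_one (by rw [hD]; linarith)) (by positivity))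
      calc |gq n a (x + e μ) y' - gq n a x y'| = |u (x + e μ) - u x| := rfl
        _ ≤ |u (x + e μ)| + |u x| := abs_sub _ _
        _ ≤ 2 * (c * 7 ^ d * (Real.exp 1 * E)) := by linarith
        _ ≤ cG d a / ((n : ℝ) + 1) * E := by
            rw [div_mul_eq_mul_div, le_div_iff₀ hs0]
            have hkey : 2 * (c * 7 ^ d * Real.exp 1) * ((n : ℝ) + 1) ≤ cG d a := by
              refine le_trans ?_ hcrude
              calc 2 * (c * 7 ^ d * Real.exp 1) * ((n : ℝ) + 1) ≤ 2 * (c * 7 ^ d * Real.exp 1) * 7 :=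
                    mul_le_mul_of_nonneg_left hn7' (by positivity)
                _ = 2 * 7 ^ (d + 1) * c * Real.exp 1 := by ring
            calc 2 * (c * 7 ^ d * (Real.exp 1 * E)) * ((n : ℝ) + 1)
                = (2 * (c * 7 ^ d * Real.exp 1) * ((n : ℝ) + 1)) * E := by ring
              _ ≤ cG d a * E := mul_le_mul_of_nonneg_right hkey hE0.le
  · -- `n + 1 ≥ 8`: the interior estimate on the cube of radius `3m`, `m = ⌊(n+1)/8⌋`
    rw [not_le] at hn7
    set m : ℕ := (n + 1) / 8 with hm
    have hm1 : 1 ≤ m := by omega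
    have h8m : 8 * m ≤ n + 1 := by omega
    have h16m : n + 1 ≤ 16 * m := by omega
    have hmR : (m : ℝ) ≤ (n : ℝ) + 1 := by exact_mod_cast (show m ≤ n + 1 by omega)
    have h16R : (n : ℝ) + 1 ≤ 16 * m := by exact_mod_cast h16m
    have hm0 : (0 : ℝ) < m := by exact_mod_cast hm1
    have h3m : 3 * m ≤ n + 1 := by omega
    -- (hA) the Laplacian bound on the cube
    set A : ℝ := (Real.exp 2 + a * c * Real.exp 1) * E / ((n : ℝ) + 1) ^ 2 with hA
    have hAbd : ∀ z ∈ cube x (3 * m), |latticeLaplacianZd u z| ≤ A := by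
      intro z hz
      have hzx : dist (blk n z) (blk n x) ≤ 1 := dist_blk_le_one_of_mem_cube h3m hz
      have hDz : D - 1 ≤ dist (blk n z) y' := hnb _ hzx
      refine (abs_lap_gq_le n ha z y').trans ?_
      rw [hA]
      apply div_le_div_of_nonneg_right _ (by positivity)
      have hind : (if blk n z = y' then (1 : ℝ) else 0) ≤ Real.exp 2 * E := by
        split_ifs with hzy
        · have hD1 : D ≤ 1 := by
            have : dist (blk n z) y' = 0 := by rw [hzy, dist_self]
            linarith
          rw [hE, ← Real.exp_add]
          exact Real.one_le_exp (by nlinarith)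
        · positivity
      have hcoarse : a * cU d a * Real.exp (-(deltaU d a * dist (blk n z) y')) ≤ a * c * Real.exp 1 * E := by
        rw [← hc, ← hδ, mul_assoc (a * c)]
        exact mul_le_mul_of_nonneg_left (henv _ 1 zero_le_one hDz) (by positivity)
      linarith
    -- (hB) the `ℓ¹` bound on the cube, through the covering by the `3^d` adjacent blocks
    set Bc : ℝ := 3 ^ d * c * ((n : ℝ) + 1) ^ d * Real.exp 1 * E with hBc
    have hBbd : (∑ z ∈ cube x (3 * m), |u z|) ≤ Bc := by
      calc (∑ z ∈ cube x (3 * m), |u z|) ≤ ∑ z ∈ U n (cube (blk n x) 1), |u z| :=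
            Finset.sum_le_sum_of_subset_of_nonneg (cube_subset_U h3m x) fun _ _ _ => abs_nonneg _
        _ = ∑ y'' ∈ cube (blk n x) 1, ∑ z ∈ B n y'', |u z| := sum_U _ _
        _ ≤ ∑ y'' ∈ cube (blk n x) 1, c * ((n : ℝ) + 1) ^ d * (Real.exp 1 * E) := by
            refine Finset.sum_le_sum fun y'' hy'' => (sum_abs_gq_le n ha y'' y').trans ?_
            rw [← hc, ← hδ]
            exact mul_le_mul_of_nonneg_left
              (henv _ 1 zero_le_one (hnb _ (by rw [dist_comm]; exact dist_le_one_of_mem_cube_one hy''))) (by positivity)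
        _ = (cube (blk n x) 1).card * (c * ((n : ℝ) + 1) ^ d * (Real.exp 1 * E)) := by
            rw [Finset.sum_const, nsmul_eq_mul]
        _ = Bc := by rw [card_cube, hBc]; push_cast; ring
    -- the interior estimate
    obtain ⟨hval, hgrad⟩ := interior_estimate_cI hd hm1 u x A Bc hAbd hBbd
    have h16d : ((n : ℝ) + 1) ^ d ≤ 16 ^ d * (m : ℝ) ^ d := by
      rw [← mul_pow]; exact pow_le_pow_left₀ hs0.le h16R d
    have h16d1 : ((n : ℝ) + 1) ^ (d + 1) ≤ 16 ^ (d + 1) * (m : ℝ) ^ (d + 1) := by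
      rw [← mul_pow]; exact pow_le_pow_left₀ hs0.le h16R (d + 1)
    have hmd : (0 : ℝ) < (m : ℝ) ^ d := by positivity
    have hP : 0 ≤ Real.exp 2 + a * c * Real.exp 1 := by positivity
    have h4816 : (3 : ℝ) ^ d * 16 ^ d ≤ 48 ^ (d + 1) := by
      rw [← mul_pow, show (3 : ℝ) * 16 = 48 by norm_num]
      exact pow_le_pow_right₀ (by norm_num) (by omega)
    have h4816' : (3 : ℝ) ^ d * 16 ^ (d + 1) ≤ 48 ^ (d + 1) := by
      rw [pow_succ (16 : ℝ), ← mul_assoc, ← mul_pow, show (3 : ℝ) * 16 = 48 by norm_num, pow_succ]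
      exact mul_le_mul_of_nonneg_left (by norm_num) (by positivity)
    have hKmain : cI d * (Real.exp 2 + a * c * Real.exp 1 + 48 ^ (d + 1) * c * Real.exp 1) ≤ cG d a := by
      unfold cG; rw [← hc]
      have : 0 ≤ 2 * 7 ^ (d + 1) * c * Real.exp 1 := by positivity
      linarith
    constructor
    · -- value leg
      have h1 : (m : ℝ) ^ 2 * A ≤ (Real.exp 2 + a * c * Real.exp 1) * E := by
        rw [hA, ← mul_div_assoc, div_le_iff₀ (by positivity)]
        have : (m : ℝ) ^ 2 ≤ ((n : ℝ) + 1) ^ 2 := pow_le_pow_left₀ hm0.le hmR 2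
        calc (m : ℝ) ^ 2 * ((Real.exp 2 + a * c * Real.exp 1) * E)
            ≤ ((n : ℝ) + 1) ^ 2 * ((Real.exp 2 + a * c * Real.exp 1) * E) :=
              mul_le_mul_of_nonneg_right this (by positivity)
          _ = _ := by ring
      have h2 : Bc / (m : ℝ) ^ d ≤ 48 ^ (d + 1) * c * Real.exp 1 * E := by
        rw [hBc, div_le_iff₀ hmd]
        calc 3 ^ d * c * ((n : ℝ) + 1) ^ d * Real.exp 1 * E = ((n : ℝ) + 1) ^ d * (3 ^ d * c * Real.exp 1 * E) := by ring
          _ ≤ 16 ^ d * (m : ℝ) ^ d * (3 ^ d * c * Real.exp 1 * E) := mul_le_mul_of_nonneg_right h16d (by positivity)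
          _ = (3 ^ d * 16 ^ d) * c * Real.exp 1 * E * (m : ℝ) ^ d := by ring
          _ ≤ 48 ^ (d + 1) * c * Real.exp 1 * E * (m : ℝ) ^ d := by gcongr
      calc |gq n a x y'| = |u x| := rfl
        _ ≤ cI d * ((m : ℝ) ^ 2 * A + Bc / (m : ℝ) ^ d) := hval
        _ ≤ cI d * ((Real.exp 2 + a * c * Real.exp 1) * E + 48 ^ (d + 1) * c * Real.exp 1 * E) :=
            mul_le_mul_of_nonneg_left (add_le_add h1 h2) hCI
        _ = cI d * (Real.exp 2 + a * c * Real.exp 1 + 48 ^ (d + 1) * c * Real.exp 1) * E := by ring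
        _ ≤ cG d a * E := mul_le_mul_of_nonneg_right hKmain hE0.le
    · -- gradient leg
      intro μ
      have h1 : (m : ℝ) * A ≤ (Real.exp 2 + a * c * Real.exp 1) * E / ((n : ℝ) + 1) := by
        rw [hA, ← mul_div_assoc, div_le_div_iff₀ (by positivity) hs0]
        have : (m : ℝ) * ((n : ℝ) + 1) ≤ ((n : ℝ) + 1) ^ 2 := by
          rw [sq]; exact mul_le_mul_of_nonneg_right hmR hs0.le
        calc (m : ℝ) * ((Real.exp 2 + a * c * Real.exp 1) * E) * ((n : ℝ) + 1)
            = ((Real.exp 2 + a * c * Real.exp 1) * E) * ((m : ℝ) * ((n : ℝ) + 1)) := by ring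
          _ ≤ ((Real.exp 2 + a * c * Real.exp 1) * E) * ((n : ℝ) + 1) ^ 2 :=
              mul_le_mul_of_nonneg_left this (by positivity)
      have h2 : Bc / (m : ℝ) ^ (d + 1) ≤ 48 ^ (d + 1) * c * Real.exp 1 * E / ((n : ℝ) + 1) := by
        rw [hBc, div_le_div_iff₀ (by positivity) hs0]
        calc 3 ^ d * c * ((n : ℝ) + 1) ^ d * Real.exp 1 * E * ((n : ℝ) + 1)
            = ((n : ℝ) + 1) ^ (d + 1) * (3 ^ d * c * Real.exp 1 * E) := by ring
          _ ≤ 16 ^ (d + 1) * (m : ℝ) ^ (d + 1) * (3 ^ d * c * Real.exp 1 * E) :=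
              mul_le_mul_of_nonneg_right h16d1 (by positivity)
          _ = (3 ^ d * 16 ^ (d + 1)) * c * Real.exp 1 * E * (m : ℝ) ^ (d + 1) := by ring
          _ ≤ 48 ^ (d + 1) * c * Real.exp 1 * E * (m : ℝ) ^ (d + 1) := by gcongr
      calc |gq n a (x + e μ) y' - gq n a x y'| = |u (x + Pi.single μ 1) - u x| := rfl
        _ ≤ cI d * ((m : ℝ) * A + Bc / (m : ℝ) ^ (d + 1)) := hgrad μ
        _ ≤ cI d * ((Real.exp 2 + a * c * Real.exp 1) * E / ((n : ℝ) + 1)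
              + 48 ^ (d + 1) * c * Real.exp 1 * E / ((n : ℝ) + 1)) :=
            mul_le_mul_of_nonneg_left (add_le_add h1 h2) hCI
        _ = cI d * (Real.exp 2 + a * c * Real.exp 1 + 48 ^ (d + 1) * c * Real.exp 1) / ((n : ℝ) + 1) * E := by ring
        _ ≤ cG d a / ((n : ℝ) + 1) * E := by
            apply mul_le_mul_of_nonneg_right _ hE0.le
            exact div_le_div_of_nonneg_right hKmain hs0.le

/-- [folklore] **SUP-NORM VALUE LEG**: `|(G′Q′*)(p,y′)| ≤ cG(d,a)·e^{−δ_u|blk p − y′|_∞}` — mesh-free (compare `B5Hk103ScalarZd.abs_gq_le`,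
which carries `(n+1)^{d/2}`). -/
theorem abs_gq_le_sup (hd : 3 ≤ d) (n : ℕ) {a : ℝ} (ha : 0 < a) (p y' : X d) :
    |gq n a p y'| ≤ cG d a * Real.exp (-(deltaU d a * dist (blk n p) y')) :=
  (gq_legs hd n ha p y').1

/-- [folklore] **SUP-NORM GRADIENT LEG** (forward difference): `|(G′Q′*)(p+e_μ,y′) − (G′Q′*)(p,y′)| ≤ cG(d,a)·(n+1)⁻¹·e^{−δ_u|blk p − y′|_∞}` —
one factor of the mesh `η = (n+1)⁻¹`: the columns are smooth at the block scale. -/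
theorem abs_gq_diff_le_sup (hd : 3 ≤ d) (n : ℕ) {a : ℝ} (ha : 0 < a) (p y' : X d) (μ : Fin d) :
    |gq n a (p + e μ) y' - gq n a p y'| ≤ cG d a / ((n : ℝ) + 1) * Real.exp (-(deltaU d a * dist (blk n p) y')) :=
  (gq_legs hd n ha p y').2 μ

/-- [folklore] The backward-difference form: `|(G′Q′*)(p−e_μ,y′) − (G′Q′*)(p,y′)| ≤ e·cG(d,a)·(n+1)⁻¹·e^{−δ_u|blk p − y′|_∞}` (the factor `e`
absorbs the one-block shift of the reference point). -/
theorem abs_gq_diff_sub_le_sup (hd : 3 ≤ d) (n : ℕ) {a : ℝ} (ha : 0 < a) (p y' : X d) (μ : Fin d) :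
    |gq n a (p - e μ) y' - gq n a p y'|
      ≤ Real.exp 1 * cG d a / ((n : ℝ) + 1) * Real.exp (-(deltaU d a * dist (blk n p) y')) := by
  have h := abs_gq_diff_le_sup hd n ha (p - e μ) y' μ
  rw [sub_add_cancel, abs_sub_comm] at h
  refine h.trans ?_
  have hδ1 := deltaU_le_one d a
  have hδ0 := (deltaU_pos d ha).le
  have htri : dist (blk n p) y' - 1 ≤ dist (blk n (p - e μ)) y' := by
    have h1 := dist_triangle (blk n p) (blk n (p - e μ)) y'
    have h2 := dist_blk_sub_e_le_one n p μ
    rw [dist_comm] at h2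
    linarith
  have hexp : Real.exp (-(deltaU d a * dist (blk n (p - e μ)) y'))
      ≤ Real.exp 1 * Real.exp (-(deltaU d a * dist (blk n p) y')) := by
    rw [← Real.exp_add]; exact Real.exp_le_exp.2 (by nlinarith)
  have hK : 0 ≤ cG d a / ((n : ℝ) + 1) := div_nonneg (cG_pos d ha).le (by positivity)
  calc cG d a / ((n : ℝ) + 1) * Real.exp (-(deltaU d a * dist (blk n (p - e μ)) y'))
      ≤ cG d a / ((n : ℝ) + 1) * (Real.exp 1 * Real.exp (-(deltaU d a * dist (blk n p) y'))) :=
        mul_le_mul_of_nonneg_left hexp hK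
    _ = _ := by ring

/-! ## §5 Consequence: the sup-norm bound for B5 (1.103)'s `H = G′Q′*(Q′G′Q′*)⁻¹` on `ℤ^d` -/

/-- [folklore] **Convolution of two exponential envelopes**: if `|f y′| ≤ A e^{−α|x−y′|}` and `|g y′| ≤ B e^{−β|y′−z|}` then
`|Σ'_{y′} f y′ g y′| ≤ A B K_d(β/2) e^{−(min(α,β)/2)|x−z|}`. -/
theorem abs_tsum_mul_le_of_decay {f g : X d → ℝ} {A B α β : ℝ} (hα : 0 < α) (hβ : 0 < β) (hA : 0 ≤ A) (hB : 0 ≤ B)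
    (x z : X d) (hf : ∀ y', |f y'| ≤ A * Real.exp (-(α * dist x y'))) (hg : ∀ y', |g y'| ≤ B * Real.exp (-(β * dist y' z))) :
    |∑' y' : X d, f y' * g y'| ≤ A * B * latticeConst d (β / 2) * Real.exp (-(min α β / 2 * dist x z)) := by
  have key : |∑' y' : X d, f y' * g y'| ≤ (A * B * Real.exp (-(min α β / 2 * dist x z))) * latticeConst d (β / 2) := by
    refine abs_tsum_le_latticeConst (half_pos hβ) (by positivity) z fun y' => ?_
    rw [abs_mul]
    have hsplit := exp_split_triangle hα.le hβ.le (dist_nonneg (x := x) (y := y')) (dist_nonneg (x := y') (y := z))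
      (dist_triangle x y' z)
    calc |f y'| * |g y'| ≤ (A * Real.exp (-(α * dist x y'))) * (B * Real.exp (-(β * dist y' z))) :=
          mul_le_mul (hf y') (hg y') (abs_nonneg _) (by positivity)
      _ = A * B * (Real.exp (-(α * dist x y')) * Real.exp (-(β * dist y' z))) := by ring
      _ ≤ A * B * (Real.exp (-(min α β / 2 * dist x z)) * Real.exp (-(β / 2 * dist y' z))) :=
          mul_le_mul_of_nonneg_left hsplit (by positivity)
      _ = A * B * Real.exp (-(min α β / 2 * dist x z)) * Real.exp (-(β / 2 * dist z y')) := by rw [dist_comm y' z]; ring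
  calc _ ≤ _ := key
    _ = _ := by ring

/-- [our object] **The sup-norm constant of `H`**: `cHs(d,a) = cG(d,a)·c_inv·K_d(δ_inv/2)`. -/
def cHs (d : ℕ) (a : ℝ) : ℝ := cG d a * cInv d a * latticeConst d (deltaInv d a / 2)

/-- [folklore] `cHs d a > 0`… at least `≥ 0` (the lattice constant is only known non-negative). -/
theorem cHs_nonneg (d : ℕ) {a : ℝ} (ha : 0 < a) : 0 ≤ cHs d a := by
  unfold cHs; have := cG_pos d ha; have := cInv_pos d ha
  have := latticeConst_nonneg d (half_pos (deltaInv_pos d ha)).le; positivity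

/-- [folklore] **SUP-NORM BOUND FOR B5 (1.103)'s `H` ON `ℤ^d`**: `|H(p,y)| ≤ cHs(d,a)·e^{−δ_H|blk p − y|_∞}` with pv23's rate
`δ_H = min(δ_u,δ_inv)/2` and NO factor `(n+1)^{d/2}` (compare `B5Hk103ScalarZd.abs_kerH_le`) — the sup-norm `O(1)` entry bound that
pv23-g7's HONEST SCOPE (iii) left open «(that needs elliptic regularity)», for the scalar `ℤ^d` object. -/
theorem abs_kerH_le_sup (hd : 3 ≤ d) (n : ℕ) {a : ℝ} (ha : 0 < a) (p y : X d) :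
    |kerH n a p y| ≤ cHs d a * Real.exp (-(deltaH d a * dist (blk n p) y)) := by
  have h := abs_tsum_mul_le_of_decay (deltaU_pos d ha) (deltaInv_pos d ha) (cG_pos d ha).le (cInv_pos d ha).le
    (blk n p) y (fun y' => abs_gq_le_sup hd n ha p y') (fun y' => abs_Kinv_le n ha y' y)
  rw [kerH]
  calc _ ≤ _ := h
    _ = cHs d a * Real.exp (-(deltaH d a * dist (blk n p) y)) := by rw [cHs, deltaH]

end

end Summit.QuantumFields.BalabanUV.Beta.D1BFx.BlockColumnSupNorm
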